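import Summits.Ventures.HodgeRepro.Night1AndreReduction

/-!
# S3 (André 1992 / Milne 2020 Theorem 1) on the kernel, III: the pulled-back Weil spaces are the Galois
ORBITS of the Pohlmann wedges — dimension = orbit length, different orbits meet trivially, and the
space of Hodge classes of `A` has dimension Pohlmann's count

Blind re-derivation cell `pub-hodge-repro`, seat `night-1` (gen 6).  Imports night-1's
`Night1AndreReduction` (André's map, the pull-back `andrePull Δ (2p) = f_Δ^*`, the wedges `e_{σ • Δ}`
(`deltaEnum`), `map_andrePull_weilSpaceProd` = «`f_Δ^*(W_F(A_Δ)) ⊗ ℂ` is the span of the Galois orbit of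
`e_Δ`» and Theorem 1 complexified).  Namespace `HodgeRepro.RouteC`.

The coordinate wedges `e_S` of DISTINCT `n`-subsets `S ⊆ X` are linearly independent (separated by the
dual functionals `setDual s = ⟨e^*_{s 0} ∧ ⋯ ∧ e^*_{s (n−1)}, ·⟩`; two enumerations of ONE set give the
same wedge up to the sign of the permutation, `coordWedgeOn_eq_sign_smul_of_image_eq`).  Hence:

* `sizedWedge S` — the canonical wedge of an `n`-set `S`; **`linearIndependent_sizedWedge`**;
* **`finrank_jointEigenspaceOn`** — the space of Hodge classes of `A` in degree `2p` (typer-2's joint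
  `(p, p)`-eigenspace of the conjugate cocharacters, `B^p(A) ⊗ ℂ` in the dictionary) has dimension
  `hodgeCountOn c Φ p` = the number of Pohlmann `2p`-subsets of `X` (typer's count) — the dimension form
  of S2 (Pohlmann's census) on the kernel;
* `orbitSets Δ = {σ • Δ : σ ∈ G}`; **`finrank_map_andrePull_weilSpaceProd`** — `dim f_Δ^*(W_F(A_Δ)) ⊗ ℂ
  = |G • Δ|` (so `f_Δ^*` is injective on `W_F(A_Δ)` exactly when the stabiliser of `Δ` is trivial);
  `card_orbitSets_mul_card_stabilizer` — orbit–stabiliser: `|G • Δ| · |Stab_G(Δ)| = |G| = [F : ℚ]`;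
* **`map_andrePull_weilSpaceProd_smul`** — `Δ` and `g • Δ` pull back the SAME subspace;
  **`disjoint_map_andrePull_weilSpaceProd`** — for `Δ'` outside the orbit of `Δ` the two pulled-back
  Weil spaces meet trivially.

With `jointEigenspaceOn_eq_iSup_map_andrePull` (Theorem 1): `B^p(A) ⊗ ℂ` is the DIRECT sum, over the
Galois orbits of Pohlmann `2p`-sets, of the pulled-back Weil spaces `f_Δ^*(W_F(A_Δ)) ⊗ ℂ`, one per orbit,
of dimension the orbit length — Milne's «the subspaces `f_Δ^*(W_F(A_Δ))` span `B^p`» (p0005:L74–76)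
refined to a direct sum with its dimensions.  Nothing geometric is built; every statement is about
coordinate wedges on finite `G`-sets.  Nothing here says anything about the status of the Hodge
conjecture for CM abelian varieties, which is NOT proved.
-/

set_option autoImplicit false

open Finset Module
open scoped Pointwise

namespace HodgeRepro.RouteC

open CMHodgeOn

/-! ### Dual functionals separate the coordinate wedges of distinct sets -/

section Dual

variable {X : Type*} [DecidableEq X]

/-- The dual functional of the coordinate wedge of `s`: `ω ↦ ⟨e^*_{s 0} ∧ ⋯ ∧ e^*_{s (n−1)}, ω⟩` (the pairing
with the wedge of the coordinate projections; night-1's `lineDual` for a general family). -/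
noncomputable def setDual {n : ℕ} (s : Fin n → X) : Module.Dual ℂ (⋀[ℂ]^n (X → ℂ)) :=
  exteriorPower.pairingDual ℂ (X → ℂ) n
    (exteriorPower.ιMulti ℂ n fun j => (LinearMap.proj (s j) : (X → ℂ) →ₗ[ℂ] ℂ))

/-- The dual functional of an injective `s` takes the value `1` on its own wedge. -/
theorem setDual_coordWedgeOn_self {n : ℕ} {s : Fin n → X} (hs : Function.Injective s) :
    setDual s (coordWedgeOn n s) = 1 :=
  pairingDual_proj_coordWedgeOn hs

/-- If some corner `s j` lies outside the set of `s'`, the pairing matrix has a zero column and the dual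
functional of `s` kills the wedge of `s'`. -/
theorem setDual_coordWedgeOn_eq_zero_of_not_mem {n : ℕ} {s s' : Fin n → X} (j : Fin n)
    (hj : s j ∉ univ.image s') : setDual s (coordWedgeOn n s') = 0 := by
  unfold setDual coordWedgeOn
  rw [exteriorPower.pairingDual_ιMulti_ιMulti]
  refine Matrix.det_eq_zero_of_column_eq_zero j fun k => ?_
  rw [Matrix.of_apply, LinearMap.proj_apply, coordVecOn_apply, if_neg]
  intro h
  exact hj (h ▸ mem_image_of_mem s' (mem_univ k))

/-- **Distinct sets are separated**: for injective `s`, `s'` with `range s ≠ range s'` the dual functional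
of `s` kills the wedge of `s'`. -/
theorem setDual_coordWedgeOn_of_image_ne {n : ℕ} {s s' : Fin n → X} (hs : Function.Injective s)
    (hs' : Function.Injective s') (h : univ.image s ≠ univ.image s') :
    setDual s (coordWedgeOn n s') = 0 := by
  obtain ⟨j, hj⟩ : ∃ j, s j ∉ univ.image s' := by
    by_contra hcon
    simp only [not_exists, not_not] at hcon
    apply h
    refine Finset.eq_of_subset_of_card_le (fun x hx => ?_) ?_
    · obtain ⟨j, -, rfl⟩ := mem_image.1 hx
      exact hcon j
    · rw [card_image_of_injective _ hs', card_image_of_injective _ hs]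
  exact setDual_coordWedgeOn_eq_zero_of_not_mem j hj

/-- **Coordinate wedges of pairwise distinct sets are linearly independent.** -/
theorem linearIndependent_coordWedgeOn {α : Type*} {n : ℕ} (s : α → Fin n → X)
    (hinj : ∀ a, Function.Injective (s a))
    (hne : Pairwise fun a b => univ.image (s a) ≠ univ.image (s b)) :
    LinearIndependent ℂ fun a => coordWedgeOn n (s a) :=
  LinearIndependent.of_pairwise_dual_eq_zero_one _ (fun a => setDual (s a))
    (fun a b hab => setDual_coordWedgeOn_of_image_ne (hinj a) (hinj b) (hne hab))
    (fun a => setDual_coordWedgeOn_self (hinj a))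

/-- **Two enumerations of one set give the same wedge up to a sign**: if injective `s`, `s'` have the same
range, `e_{s'} = sign(π) • e_s` for the permutation `π` with `s' = s ∘ π`. -/
theorem coordWedgeOn_eq_sign_smul_of_image_eq {n : ℕ} {s s' : Fin n → X} (hs : Function.Injective s)
    (hs' : Function.Injective s') (h : univ.image s = univ.image s') :
    ∃ π : Equiv.Perm (Fin n), coordWedgeOn n s' = (((Equiv.Perm.sign π : ℤ) : ℂ)) • coordWedgeOn n s := by
  have hcard : Fintype.card (↥(univ.image s)) = n := by
    rw [Fintype.card_coe, card_image_of_injective _ hs, card_univ, Fintype.card_fin]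
  have hbij : Function.Bijective fun j : Fin n => (⟨s j, mem_image_of_mem s (mem_univ j)⟩ : ↥(univ.image s)) := by
    rw [Fintype.bijective_iff_injective_and_card]
    exact ⟨fun a b hab => hs (congrArg Subtype.val hab), by rw [Fintype.card_fin, hcard]⟩
  have hbij' : Function.Bijective fun j : Fin n =>
      (⟨s' j, h ▸ mem_image_of_mem s' (mem_univ j)⟩ : ↥(univ.image s)) := by
    rw [Fintype.bijective_iff_injective_and_card]
    exact ⟨fun a b hab => hs' (congrArg Subtype.val hab), by rw [Fintype.card_fin, hcard]⟩
  let es : Fin n ≃ ↥(univ.image s) := Equiv.ofBijective _ hbij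
  let es' : Fin n ≃ ↥(univ.image s) := Equiv.ofBijective _ hbij'
  refine ⟨es'.trans es.symm, ?_⟩
  have hcomp : s' = s ∘ (es'.trans es.symm) := by
    funext j
    show s' j = s (es.symm (es' j))
    exact (congrArg Subtype.val (es.apply_symm_apply (es' j))).symm
  rw [hcomp]
  unfold coordWedgeOn
  have h1 := AlternatingMap.map_perm (exteriorPower.ιMulti ℂ n (M := X → ℂ)) (fun j => coordVecOn (s j))
    (es'.trans es.symm)
  rw [Units.smul_def, ← Int.cast_smul_eq_zsmul (R := ℂ)] at h1
  exact h1

end Dual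

/-! ### The canonical wedge of an `n`-set, and the dimension of the space of Hodge classes -/

section Sized

variable {X : Type*} [Fintype X] [DecidableEq X]

/-- The canonical enumeration of an `n`-set `S ⊆ X` (`Finset.equivFinOfCardEq`). -/
noncomputable def setEnum {n : ℕ} (S : Finset X) (h : S.card = n) : Fin n → X :=
  fun j => ((Finset.equivFinOfCardEq h).symm j : X)

omit [Fintype X] [DecidableEq X] in
/-- The canonical enumeration is injective. -/
theorem setEnum_injective {n : ℕ} (S : Finset X) (h : S.card = n) : Function.Injective (setEnum S h) :=
  fun _ _ hab => (Finset.equivFinOfCardEq h).symm.injective (Subtype.ext hab)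

omit [Fintype X] in
/-- The canonical enumeration enumerates `S`. -/
theorem image_setEnum {n : ℕ} (S : Finset X) (h : S.card = n) : univ.image (setEnum S h) = S := by
  ext x
  simp only [mem_image, mem_univ, true_and, setEnum]
  exact ⟨fun ⟨j, hj⟩ => hj ▸ ((Finset.equivFinOfCardEq h).symm j).2,
    fun hx => ⟨Finset.equivFinOfCardEq h ⟨x, hx⟩, by rw [Equiv.symm_apply_apply]⟩⟩

/-- The `n`-subsets of `X`. -/
abbrev SizedSets (X : Type*) (n : ℕ) : Type _ := {S : Finset X // S.card = n}

/-- The canonical wedge `e_S` of an `n`-set `S`. -/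
noncomputable def sizedWedge {n : ℕ} (S : SizedSets X n) : ⋀[ℂ]^n (X → ℂ) :=
  coordWedgeOn n (setEnum S.1 S.2)

omit [Fintype X] in
/-- The canonical wedges of the `n`-subsets of `X` are linearly independent. -/
theorem linearIndependent_sizedWedge (n : ℕ) : LinearIndependent ℂ (sizedWedge (X := X) (n := n)) :=
  linearIndependent_coordWedgeOn (fun S : SizedSets X n => setEnum S.1 S.2)
    (fun S => setEnum_injective S.1 S.2) (fun S S' hne => by
      dsimp only
      rw [image_setEnum, image_setEnum]
      exact fun e => hne (Subtype.ext e))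

omit [Fintype X] in
/-- Every coordinate wedge of an injective `s` is `± sizedWedge ⟨range s, _⟩`. -/
theorem coordWedgeOn_eq_sign_smul_sizedWedge {n : ℕ} {s : Fin n → X} (hs : Function.Injective s) :
    ∃ π : Equiv.Perm (Fin n), coordWedgeOn n s = (((Equiv.Perm.sign π : ℤ) : ℂ)) •
      sizedWedge ⟨univ.image s, by rw [card_image_of_injective _ hs, card_univ, Fintype.card_fin]⟩ := by
  unfold sizedWedge
  exact coordWedgeOn_eq_sign_smul_of_image_eq (setEnum_injective _ _) hs (by rw [image_setEnum])

omit [Fintype X] in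
/-- The span of a family of coordinate wedges of injective enumerations is the span of the canonical
wedges of their ranges. -/
theorem span_coordWedgeOn_eq_span_sizedWedge_image {α : Type*} {n : ℕ} (s : α → Fin n → X)
    (hinj : ∀ a, Function.Injective (s a)) :
    Submodule.span ℂ (Set.range fun a => coordWedgeOn n (s a)) =
      Submodule.span ℂ (sizedWedge '' {S : SizedSets X n | ∃ a, S.1 = univ.image (s a)}) := by
  refine le_antisymm (Submodule.span_le.2 ?_) (Submodule.span_le.2 ?_)
  · rintro _ ⟨a, rfl⟩
    obtain ⟨π, hπ⟩ := coordWedgeOn_eq_sign_smul_sizedWedge (hinj a)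
    show coordWedgeOn n (s a) ∈ Submodule.span ℂ _
    rw [hπ]
    exact Submodule.smul_mem _ _ (Submodule.subset_span ⟨_, ⟨a, rfl⟩, rfl⟩)
  · rintro _ ⟨S, ⟨a, ha⟩, rfl⟩
    obtain ⟨π, hπ⟩ := coordWedgeOn_eq_sign_smul_of_image_eq (hinj a) (setEnum_injective S.1 S.2)
      (by rw [image_setEnum, ha])
    rw [SetLike.mem_coe]
    show coordWedgeOn n (setEnum S.1 S.2) ∈ _
    rw [hπ]
    exact Submodule.smul_mem _ _ (Submodule.subset_span ⟨a, rfl⟩)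

end Sized

section Count

variable {G : Type*} [Group G] [DecidableEq G] [Fintype G] {X : Type*} [MulAction G X] [Fintype X]
  [DecidableEq X]

/-- The Pohlmann `2p`-subsets of `(X, Φ)`, as a subtype of the `2p`-subsets. -/
abbrev PohlmannSets (c : G) (Φ : Finset X) (p : ℕ) : Type _ :=
  {S : SizedSets X (2 * p) // IsHodgeSetOn c Φ S.1}

/-- The canonical wedge of a Pohlmann `2p`-set. -/
noncomputable def pohlmannWedge (c : G) (Φ : Finset X) (p : ℕ) (S : PohlmannSets c Φ p) :
    ⋀[ℂ]^(2 * p) (X → ℂ) :=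
  sizedWedge S.1

omit [DecidableEq G] [Fintype G] [Fintype X] in
/-- The canonical wedges of the Pohlmann sets are linearly independent. -/
theorem linearIndependent_pohlmannWedge (c : G) (Φ : Finset X) (p : ℕ) :
    LinearIndependent ℂ (pohlmannWedge c Φ p) :=
  (linearIndependent_sizedWedge (2 * p)).comp _ Subtype.val_injective

omit [DecidableEq G] [Fintype G] in
/-- **The Hodge classes are spanned by the canonical Pohlmann wedges**: typer-2's joint `(p, p)`-eigenspace
is the span of `pohlmannWedge c Φ p`. -/
theorem span_range_pohlmannWedge {c : G} (hc : IsComplexConj c) {Φ : Finset X} (hΦ : IsCMTypeOn c Φ)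
    (p : ℕ) :
    Submodule.span ℂ (Set.range (pohlmannWedge c Φ p)) =
      jointEigenspaceOn (fun g : G => g • Φ) (2 * p) p := by
  rw [jointEigenspaceOn_smul_eq_span_pohlmannWedgesOn hc hΦ p]
  refine le_antisymm (Submodule.span_le.2 ?_) (Submodule.span_le.2 ?_)
  · rintro _ ⟨S, rfl⟩
    refine Submodule.subset_span ⟨setEnum S.1.1 S.1.2, setEnum_injective _ _, ?_, rfl⟩
    rw [image_setEnum]
    exact S.2
  · rintro _ ⟨s, hs, hS, rfl⟩
    obtain ⟨π, hπ⟩ := coordWedgeOn_eq_sign_smul_sizedWedge hs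
    rw [SetLike.mem_coe, hπ]
    exact Submodule.smul_mem _ _ (Submodule.subset_span ⟨⟨_, hS⟩, rfl⟩)

omit [DecidableEq G] in
/-- The number of Pohlmann `2p`-sets is typer's `hodgeCountOn`. -/
theorem card_pohlmannSets (c : G) (Φ : Finset X) (p : ℕ) :
    Fintype.card (PohlmannSets c Φ p) = hodgeCountOn c Φ p := by
  rw [Fintype.card_congr (Equiv.subtypeSubtypeEquivSubtypeInter (fun S : Finset X => S.card = 2 * p)
    (fun S => IsHodgeSetOn c Φ S)), Fintype.card_subtype]
  rfl

omit [DecidableEq G] in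
/-- **`dim B^p(A) ⊗ ℂ = hodgeCountOn c Φ p`**: the space of Hodge classes of `A` in degree `2p` (the joint
`(p, p)`-eigenspace of the conjugate cocharacters) has dimension the number of Pohlmann `2p`-subsets of
the embeddings — the dimension form of Pohlmann's census (S2) on the kernel. -/
theorem finrank_jointEigenspaceOn {c : G} (hc : IsComplexConj c) {Φ : Finset X} (hΦ : IsCMTypeOn c Φ)
    (p : ℕ) :
    finrank ℂ (jointEigenspaceOn (fun g : G => g • Φ) (2 * p) p) = hodgeCountOn c Φ p := by
  rw [← span_range_pohlmannWedge hc hΦ p, finrank_span_eq_card (linearIndependent_pohlmannWedge c Φ p),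
    card_pohlmannSets]

end Count

/-! ### The Galois orbit of `Δ`: the dimension of `f_Δ^*(W_F(A_Δ))`, same orbit = same image, different
orbits = trivial intersection -/

section Orbit

variable {G : Type*} [Group G] [DecidableEq G] [Fintype G] {X : Type*} [MulAction G X] [Fintype X]
  [DecidableEq X]

/-- The Galois orbit of `Δ` among the subsets of `X`: `{σ • Δ : σ ∈ G}`. -/
def orbitSets (Δ : Finset X) : Finset (Finset X) := univ.image fun σ : G => σ • Δ

omit [DecidableEq G] [Fintype X] in
/-- Membership in the orbit. -/
theorem mem_orbitSets {Δ S : Finset X} : S ∈ orbitSets (G := G) Δ ↔ ∃ σ : G, σ • Δ = S := by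
  simp [orbitSets]

omit [DecidableEq G] [Fintype X] in
/-- `Δ` lies in its own orbit. -/
theorem mem_orbitSets_self (Δ : Finset X) : Δ ∈ orbitSets (G := G) Δ :=
  mem_orbitSets.2 ⟨1, one_smul _ _⟩

omit [DecidableEq G] [Fintype X] in
/-- The orbit of a translate is the orbit. -/
theorem orbitSets_smul (g : G) (Δ : Finset X) : orbitSets (G := G) (g • Δ) = orbitSets (G := G) Δ := by
  ext S
  simp only [mem_orbitSets]
  exact ⟨fun ⟨σ, h⟩ => ⟨σ * g, by rw [mul_smul, h]⟩,
    fun ⟨σ, h⟩ => ⟨σ * g⁻¹, by rw [mul_smul, inv_smul_smul, h]⟩⟩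

omit [DecidableEq G] [Fintype X] in
/-- Orbits are disjoint or equal: `S` in the orbit of `Δ` and of `Δ'` puts `Δ'` in the orbit of `Δ`. -/
theorem mem_orbitSets_of_mem_of_mem {Δ Δ' S : Finset X} (h : S ∈ orbitSets (G := G) Δ)
    (h' : S ∈ orbitSets (G := G) Δ') : Δ' ∈ orbitSets (G := G) Δ := by
  obtain ⟨σ, rfl⟩ := mem_orbitSets.1 h
  obtain ⟨τ, hτ⟩ := mem_orbitSets.1 h'
  exact mem_orbitSets.2 ⟨τ⁻¹ * σ, by rw [mul_smul, ← hτ, inv_smul_smul]⟩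

omit [DecidableEq G] [Fintype X] in
/-- Every member of the orbit of a `2p`-set is a `2p`-set. -/
theorem card_of_mem_orbitSets {Δ S : Finset X} (h : S ∈ orbitSets (G := G) Δ) : S.card = Δ.card := by
  obtain ⟨σ, rfl⟩ := mem_orbitSets.1 h
  exact card_smul_finset σ Δ

omit [DecidableEq G] [Fintype X] in
/-- The orbit of `Δ`, read among the `n`-sets. -/
def orbitSized (n : ℕ) (Δ : Finset X) : Set (SizedSets X n) := {S | S.1 ∈ orbitSets (G := G) Δ}

omit [DecidableEq G] [Fintype X] in
/-- Membership in the orbit among the `n`-sets. -/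
@[simp] theorem mem_orbitSized {n : ℕ} {Δ : Finset X} {S : SizedSets X n} :
    S ∈ orbitSized (G := G) n Δ ↔ S.1 ∈ orbitSets (G := G) Δ := Iff.rfl

omit [Fintype X] in
/-- **The image of the Weil space of `A_Δ` under `f_Δ^*` is the span of the canonical wedges of the orbit
of `Δ`.** -/
theorem map_andrePull_weilSpaceProd_eq_span_orbit {p : ℕ} (Δ : Finset X) (e : Fin (2 * p) ≃ ↥Δ) :
    (weilSpaceProd G p e).map (andrePull Δ (2 * p)) =
      Submodule.span ℂ (sizedWedge '' orbitSized (G := G) (2 * p) Δ) := by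
  rw [map_andrePull_weilSpaceProd, span_coordWedgeOn_eq_span_sizedWedge_image _
    (fun σ => deltaEnum_injective Δ e σ)]
  congr 2
  ext S
  simp only [Set.mem_setOf_eq, mem_orbitSized, mem_orbitSets, image_deltaEnum]
  exact ⟨fun ⟨σ, hσ⟩ => ⟨σ, hσ.symm⟩, fun ⟨σ, hσ⟩ => ⟨σ, hσ.symm⟩⟩

/-- The canonical wedge, indexed by the orbit of `Δ` (a `2p`-set). -/
noncomputable def orbitWedge {p : ℕ} (Δ : Finset X) (hΔ : Δ.card = 2 * p)
    (S : ↥(orbitSets (G := G) Δ)) : ⋀[ℂ]^(2 * p) (X → ℂ) :=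
  sizedWedge ⟨S.1, (card_of_mem_orbitSets S.2).trans hΔ⟩

omit [DecidableEq G] [Fintype X] in
/-- The wedges of the orbit are linearly independent. -/
theorem linearIndependent_orbitWedge {p : ℕ} (Δ : Finset X) (hΔ : Δ.card = 2 * p) :
    LinearIndependent ℂ (orbitWedge (G := G) Δ hΔ) :=
  (linearIndependent_sizedWedge (2 * p)).comp
    (fun S : ↥(orbitSets (G := G) Δ) => (⟨S.1, (card_of_mem_orbitSets S.2).trans hΔ⟩ : SizedSets X (2 * p)))
    (fun _ _ h => Subtype.ext (congrArg (fun T : SizedSets X (2 * p) => T.1) h))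

omit [Fintype X] in
/-- The image of the Weil space is the span of the orbit wedges. -/
theorem map_andrePull_weilSpaceProd_eq_span_range_orbitWedge {p : ℕ} (Δ : Finset X)
    (e : Fin (2 * p) ≃ ↥Δ) (hΔ : Δ.card = 2 * p) :
    (weilSpaceProd G p e).map (andrePull Δ (2 * p)) =
      Submodule.span ℂ (Set.range (orbitWedge (G := G) Δ hΔ)) := by
  rw [map_andrePull_weilSpaceProd_eq_span_orbit Δ e]
  congr 1
  ext ω
  exact ⟨fun ⟨S, hS, h⟩ => ⟨⟨S.1, hS⟩, h⟩,
    fun ⟨S, h⟩ => ⟨⟨S.1, (card_of_mem_orbitSets S.2).trans hΔ⟩, S.2, h⟩⟩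

omit [Fintype X] in
/-- **`dim f_Δ^*(W_F(A_Δ)) ⊗ ℂ = |G • Δ|`**: the pulled-back Weil space has dimension the length of the
Galois orbit of `Δ` (Milne p0005:L57–66: the `|G|` lines `H^{2p}(A_Δ)_{Δ×{t}}` are carried onto the
`|G • Δ|` lines `H^{2p}(A)_{t∘Δ}`). -/
theorem finrank_map_andrePull_weilSpaceProd {p : ℕ} (Δ : Finset X) (e : Fin (2 * p) ≃ ↥Δ)
    (hΔ : Δ.card = 2 * p) :
    finrank ℂ ((weilSpaceProd G p e).map (andrePull Δ (2 * p))) = (orbitSets (G := G) Δ).card := by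
  rw [map_andrePull_weilSpaceProd_eq_span_range_orbitWedge Δ e hΔ,
    finrank_span_eq_card (linearIndependent_orbitWedge Δ hΔ), Fintype.card_coe]

omit [DecidableEq G] [Fintype X] in
/-- The orbit of `Δ` among subsets is Mathlib's `MulAction.orbit`, as a finset. -/
theorem toFinset_orbit_eq_orbitSets (Δ : Finset X) [Fintype (MulAction.orbit G Δ)] :
    (MulAction.orbit G Δ).toFinset = orbitSets (G := G) Δ := by
  ext S
  rw [Set.mem_toFinset, MulAction.mem_orbit_iff, mem_orbitSets]

omit [DecidableEq G] [Fintype X] in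
/-- **Orbit–stabiliser for the orbit of `Δ`**: `|G • Δ| · |Stab_G(Δ)| = |G|`. -/
theorem card_orbitSets_mul_card_stabilizer (Δ : Finset X) [Fintype (MulAction.orbit G Δ)]
    [Fintype (MulAction.stabilizer G Δ)] :
    (orbitSets (G := G) Δ).card * Fintype.card (MulAction.stabilizer G Δ) = Fintype.card G := by
  rw [← toFinset_orbit_eq_orbitSets, Set.toFinset_card]
  exact MulAction.card_orbit_mul_card_stabilizer_eq_card_group G Δ

omit [Fintype X] in
/-- **Same orbit, same image**: `Δ` and `g • Δ` pull their Weil spaces back to the same subspace of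
`H^{2p}(A) ⊗ ℂ`. -/
theorem map_andrePull_weilSpaceProd_smul {p : ℕ} (Δ : Finset X) (e : Fin (2 * p) ≃ ↥Δ) (g : G)
    (e' : Fin (2 * p) ≃ ↥(g • Δ)) :
    (weilSpaceProd G p e').map (andrePull (g • Δ) (2 * p)) =
      (weilSpaceProd G p e).map (andrePull Δ (2 * p)) := by
  rw [map_andrePull_weilSpaceProd_eq_span_orbit Δ e,
    map_andrePull_weilSpaceProd_eq_span_orbit (g • Δ) e']
  congr 2
  ext S
  simp only [mem_orbitSized, orbitSets_smul]

omit [Fintype X] in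
/-- **Different orbits meet trivially**: for `Δ'` outside the orbit of `Δ`, the pulled-back Weil spaces
of `A_Δ` and `A_{Δ'}` intersect in `0` (the orbits are disjoint sets of basis wedges). -/
theorem disjoint_map_andrePull_weilSpaceProd {p : ℕ} (Δ Δ' : Finset X) (e : Fin (2 * p) ≃ ↥Δ)
    (e' : Fin (2 * p) ≃ ↥Δ') (h : Δ' ∉ orbitSets (G := G) Δ) :
    Disjoint ((weilSpaceProd G p e).map (andrePull Δ (2 * p)))
      ((weilSpaceProd G p e').map (andrePull Δ' (2 * p))) := by
  rw [map_andrePull_weilSpaceProd_eq_span_orbit Δ e, map_andrePull_weilSpaceProd_eq_span_orbit Δ' e']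
  refine (linearIndependent_sizedWedge _).disjoint_span_image ?_
  rw [Set.disjoint_left]
  intro S hS hS'
  exact h (mem_orbitSets_of_mem_of_mem hS hS')

end Orbit

end HodgeRepro.RouteC
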